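import Summits.ValiantsHypothesis.ValiantsHypothesis.Theorems.KPlusLogSqLawTropicalBAtomBudget

/-!
# Route «KPlusLogSqLaw», crux `TropicalB` (stmt-ValiantsHypothesis-19771) — LONG-RANGE ATOMS: the MIDPOINT LAW for composite pairs of a
# counting-tight chain, and SECOND-ORDER ATOMICITY (a composite pair two steps apart forces an arithmetic progression of slopes)

HONEST FRAMING.  Helper toward the registered stub `stub_tropThin` (⟺ `TropicalB`, OPEN) of `Cruxes/TropicalB/Lines/birth.lean`
(crux `Summit.ValiantsHypothesis.ValiantsHypothesis.Theses.KPlusLogSqLaw.TropicalB`, item `stmt-ValiantsHypothesis-19771`, route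
`KPlusLogSqLaw`; cell `pub-symmetroid`, seat val-sym-trop-p1 g21, 2026-08-28; `--supports … --as helper`).  A STRUCTURE law valid for every
dominance design at every format (no hypothesis on exponents, valuations, support or signs).  It extends the ATOM BUDGET law of this lineage
(`AtomBudget.atomic_of_card_slopeSet_le`: in a chain exhausting the slope budget every CONSECUTIVE step moves one orbit) from consecutive
terms to ARBITRARY PAIRS of chain terms.  Nothing here bounds `TropicalB` in its window or bears on `WeakLifting`, DoorA26 / DoorA34,
`MatrixDescartes` (stmt-ValiantsHypothesis-18050) or VP ≠ VNP.

THE LAWS.  Let `p₀ ≺ … ≺ pₙ` be dominant terms of one design at strictly increasing integer slopes with distinct consecutive terms, and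
suppose the chain EXHAUSTS THE SLOPE BUDGET, `#slopeSet m d ≤ n + 1` (e.g. a counting-tight chain, `multichoose K m ≤ n + 1`).  Call a pair
`(p_k, p_k')`, `k < k'`, COMPOSITE if some column set `T` invariant under the quotient `σ_k⁻¹ σ_k'` separates the changes (the two terms
differ somewhere on `T` and somewhere off `T`).
* `slopeSet_eq_image` — the chain visits EVERY achievable slope (pigeonhole): `slopeSet m d` is the image of `k ↦ slope p_k`.
* `exists_between_of_split` — **LONG-RANGE HYBRID LAW**: for a composite pair `(p_k, p_k')` with separating block `T`, the hybrid slope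
  `Σ_{b ∈ T} d(λ_k' b) + Σ_{b ∉ T} d(λ_k b)` IS the slope of a chain term `p_i` with `k < i < k'` (the hybrid is a present term with slope
  strictly inside the gap — `AtomBudget.exists_present_slope_between` — and every achievable slope is a chain slope).
* `midpoint_law` — **MIDPOINT LAW**: for a composite pair, `slope p_k + slope p_k' = slope p_i + slope p_j` for chain indices
  `k < i < k'`, `k < j < k'` (the block `T` and its complement each land on an intermediate term).
* `two_apart_ap` / `two_apart_block` — **SECOND-ORDER ATOMICITY**: if `(p_k, p_{k+2})` is composite then the three slopes are in ARITHMETIC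
  PROGRESSION, `slope p_k + slope p_{k+2} = 2·slope p_{k+1}`, and each of the two blocks carries exactly the common difference;
  contrapositive `two_apart_atomic_of_not_ap`: where three consecutive slopes are NOT in arithmetic progression, the terms two apart still
  differ by ONE orbit of `σ_k⁻¹σ_{k+2}` (a single cycle with its re-classings, or one re-classed column).
* census currency: `midpoint_law_of_multichoose_le`, `two_apart_ap_of_multichoose_le` (counting-tight chains, signed hypotheses of `TropRow`).
LOCATED CHECK (seat folder py/aplaw.py, 0.1 s): on the kernel's counting-tight `(5,4)` chain of 56 terms (…TropicalCensusFiveFourTight, d = (0,7,22,34))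
the pairs two apart are composite at exactly 4 positions (k = 0, 30, 45, 53), each time with slopes in arithmetic progression and both blocks
carrying the common difference (7, 3, 3, 12), and the midpoint law holds for all pairs up to 7 apart — the laws are not vacuous on extremal chains.
[exchange argument (cyclewise monotonicity, tree) + pigeonhole; the packaging is this cell's, no citation exists]
-/

set_option linter.dupNamespace false
set_option autoImplicit false

namespace Summit.ValiantsHypothesis.ValiantsHypothesis.Theorems.KPlusLogSqLaw.LongRangeAtom

open Summit.ValiantsHypothesis.ValiantsHypothesis.Theorems.MatrixDescartes.Negative
open Summit.ValiantsHypothesis.ValiantsHypothesis.Theorems.LacunarySymmetroidMatrixDescartes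
open Summit.ValiantsHypothesis.ValiantsHypothesis.Theorems.LacunarySymmetroidMatrixDescartes.TropicalCensus
open Summit.ValiantsHypothesis.ValiantsHypothesis.Theorems.KPlusLogSqLaw.Sumset
open Summit.ValiantsHypothesis.ValiantsHypothesis.Theorems.KPlusLogSqLaw.AtomBudget
open scoped BigOperators
open Finset

variable {m K : ℕ}

/-! ## 1. Bookkeeping: slopes split over a block, invariance of the complement -/

/-- the slope of a term splits over any column set and its complement. [folklore] -/
theorem slope_eq_sum_add_sum_compl (d : Fin K → ℕ) (p : Equiv.Perm (Fin m) × (Fin m → Fin K)) (T : Finset (Fin m)) :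
    TropicalCensus.slope d p = ∑ b ∈ T, (d (p.2 b) : ℤ) + ∑ b ∈ Tᶜ, (d (p.2 b) : ℤ) := by
  unfold TropicalCensus.slope
  exact (Finset.sum_add_sum_compl T _).symm

/-- the slope of a hybrid term (`q` on `T`, `p` off `T`). [folklore] -/
theorem slope_hybrid (d : Fin K → ℕ) (p q r : Equiv.Perm (Fin m) × (Fin m → Fin K)) (T : Finset (Fin m))
    (hrT : ∀ b ∈ T, r.1 b = q.1 b ∧ r.2 b = q.2 b) (hrT' : ∀ b ∉ T, r.1 b = p.1 b ∧ r.2 b = p.2 b) :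
    TropicalCensus.slope d r = ∑ b ∈ T, (d (q.2 b) : ℤ) + ∑ b ∈ Tᶜ, (d (p.2 b) : ℤ) := by
  rw [slope_eq_sum_add_sum_compl d r T]
  congr 1
  · exact Finset.sum_congr rfl fun b hb => by rw [(hrT b hb).2]
  · exact Finset.sum_congr rfl fun b hb => by rw [(hrT' b (Finset.mem_compl.mp hb)).2]

/-- the complement of an invariant column set is invariant. [folklore] -/
theorem compl_invariant (π : Equiv.Perm (Fin m)) (T : Finset (Fin m)) (hT : ∀ b, π b ∈ T ↔ b ∈ T) :
    ∀ b, π b ∈ Tᶜ ↔ b ∈ Tᶜ := fun b => by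
  rw [Finset.mem_compl, Finset.mem_compl, not_iff_not]; exact hT b

/-! ## 2. General designs: the two hybrids of a composite pair -/

/-- **THE TWO HYBRIDS OF A COMPOSITE PAIR.**  If `p` is dominant at `θ₁`, `q` at `θ₂ > θ₁`, and an invariant column set `T` of `σ_p⁻¹σ_q`
separates the changes, then BOTH hybrids (`q` on `T`, `p` off `T`; and `p` on `T`, `q` off `T`) are present terms with slopes strictly
between `slope p` and `slope q`, and their slopes add up to `slope p + slope q`. [exchange argument; this packaging is the cell's] -/
theorem exists_two_hybrids (d : Fin K → ℕ) (v ε : Fin m → Fin m → Fin K → ℤ) {θ₁ θ₂ : ℤ} (hθ : θ₁ < θ₂)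
    {p q : Equiv.Perm (Fin m) × (Fin m → Fin K)} (hp : IsDominant d v ε θ₁ p) (hq : IsDominant d v ε θ₂ q)
    (T : Finset (Fin m)) (hT : ∀ b, (p.1⁻¹ * q.1) b ∈ T ↔ b ∈ T)
    (hin : ∃ b ∈ T, p.1 b ≠ q.1 b ∨ p.2 b ≠ q.2 b) (hout : ∃ b ∉ T, p.1 b ≠ q.1 b ∨ p.2 b ≠ q.2 b) :
    ∃ r r' : Equiv.Perm (Fin m) × (Fin m → Fin K), termSign ε r ≠ 0 ∧ termSign ε r' ≠ 0 ∧
      TropicalCensus.slope d r = ∑ b ∈ T, (d (q.2 b) : ℤ) + ∑ b ∈ Tᶜ, (d (p.2 b) : ℤ) ∧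
      TropicalCensus.slope d r' = ∑ b ∈ T, (d (p.2 b) : ℤ) + ∑ b ∈ Tᶜ, (d (q.2 b) : ℤ) ∧
      TropicalCensus.slope d p < TropicalCensus.slope d r ∧ TropicalCensus.slope d r < TropicalCensus.slope d q ∧
      TropicalCensus.slope d p < TropicalCensus.slope d r' ∧ TropicalCensus.slope d r' < TropicalCensus.slope d q ∧
      TropicalCensus.slope d r + TropicalCensus.slope d r' = TropicalCensus.slope d p + TropicalCensus.slope d q := by
  obtain ⟨r, hr, hrT, hrT', h₁, h₂⟩ := exists_present_slope_between d v ε hθ hp hq T hT hin hout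
  have hTc := compl_invariant (p.1⁻¹ * q.1) T hT
  have hin' : ∃ b ∈ Tᶜ, p.1 b ≠ q.1 b ∨ p.2 b ≠ q.2 b := by
    obtain ⟨b, hb, h⟩ := hout; exact ⟨b, Finset.mem_compl.mpr hb, h⟩
  have hout' : ∃ b ∉ Tᶜ, p.1 b ≠ q.1 b ∨ p.2 b ≠ q.2 b := by
    obtain ⟨b, hb, h⟩ := hin; exact ⟨b, fun hc => (Finset.mem_compl.mp hc) hb, h⟩
  obtain ⟨r', hr', hr'T, hr'T', h₁', h₂'⟩ := exists_present_slope_between d v ε hθ hp hq Tᶜ hTc hin' hout'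
  have sr := slope_hybrid d p q r T hrT hrT'
  have sr' : TropicalCensus.slope d r' = ∑ b ∈ T, (d (p.2 b) : ℤ) + ∑ b ∈ Tᶜ, (d (q.2 b) : ℤ) := by
    rw [slope_hybrid d p q r' Tᶜ hr'T hr'T', compl_compl, add_comm]
  refine ⟨r, r', hr, hr', sr, sr', h₁, h₂, h₁', h₂', ?_⟩
  rw [sr, sr', slope_eq_sum_add_sum_compl d p T, slope_eq_sum_add_sum_compl d q T]
  ring

/-! ## 3. Chains exhausting the slope budget: every achievable slope is a chain slope -/

section Chain

variable (d : Fin K → ℕ) (v ε : Fin m → Fin m → Fin K → ℤ) {n : ℕ}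
  (θ : Fin (n + 1) → ℤ) (p : Fin (n + 1) → Equiv.Perm (Fin m) × (Fin m → Fin K))

/-- slopes strictly increase along a dominant chain with distinct consecutive terms. [folklore] -/
theorem slope_strictMono (hθ : StrictMono θ) (hdom : ∀ k, IsDominant d v ε (θ k) (p k))
    (hne : ∀ k : Fin n, p k.castSucc ≠ p k.succ) : StrictMono fun k => TropicalCensus.slope d (p k) := by
  rw [Fin.strictMono_iff_lt_succ]
  intro k
  exact slope_lt_of_dominant d v ε (hθ Fin.castSucc_lt_succ) (hne k) (hdom _) (hdom _)

/-- **A chain exhausting the slope budget visits every achievable slope** (pigeonhole: its `n + 1` pairwise distinct slopes lie in a set of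
at most `n + 1` achievable slopes). [folklore] -/
theorem slopeSet_eq_image (hθ : StrictMono θ) (hdom : ∀ k, IsDominant d v ε (θ k) (p k))
    (hne : ∀ k : Fin n, p k.castSucc ≠ p k.succ) (htight : (slopeSet m d).card ≤ n + 1) :
    slopeSet m d = (univ : Finset (Fin (n + 1))).image fun k => TropicalCensus.slope d (p k) := by
  classical
  have hsm := slope_strictMono d v ε θ p hθ hdom hne
  have hsub : ((univ : Finset (Fin (n + 1))).image fun k => TropicalCensus.slope d (p k)) ⊆ slopeSet m d := by
    intro s hs
    obtain ⟨k, -, rfl⟩ := Finset.mem_image.mp hs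
    exact slope_mem_slopeSet d (p k)
  have hcard : ((univ : Finset (Fin (n + 1))).image fun k => TropicalCensus.slope d (p k)).card = n + 1 := by
    rw [Finset.card_image_of_injective _ hsm.injective, card_univ, Fintype.card_fin]
  exact (Finset.eq_of_subset_of_card_le hsub (by rw [hcard]; exact htight)).symm

/-- every achievable slope is the slope of some chain term. [folklore] -/
theorem exists_index_of_mem_slopeSet (hθ : StrictMono θ) (hdom : ∀ k, IsDominant d v ε (θ k) (p k))
    (hne : ∀ k : Fin n, p k.castSucc ≠ p k.succ) (htight : (slopeSet m d).card ≤ n + 1) {s : ℤ} (hs : s ∈ slopeSet m d) :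
    ∃ i : Fin (n + 1), TropicalCensus.slope d (p i) = s := by
  classical
  rw [slopeSet_eq_image d v ε θ p hθ hdom hne htight] at hs
  obtain ⟨i, -, hi⟩ := Finset.mem_image.mp hs
  exact ⟨i, hi⟩

/-! ## 4. The long-range hybrid law and the midpoint law -/

/-- **LONG-RANGE HYBRID LAW.**  In a chain exhausting the slope budget, let `k < k'` and let `T` be a column set invariant under
`σ_k⁻¹σ_k'` separating the changes of the pair `(p_k, p_k')`.  Then the hybrid slope `Σ_{b ∈ T} d(λ_k' b) + Σ_{b ∉ T} d(λ_k b)` is the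
slope of a chain term STRICTLY BETWEEN: `slope p_i`, `k < i < k'`. [this cell] -/
theorem exists_between_of_split (hθ : StrictMono θ) (hdom : ∀ k, IsDominant d v ε (θ k) (p k))
    (hne : ∀ k : Fin n, p k.castSucc ≠ p k.succ) (htight : (slopeSet m d).card ≤ n + 1)
    {k k' : Fin (n + 1)} (hkk' : k < k') (T : Finset (Fin m)) (hT : ∀ b, ((p k).1⁻¹ * (p k').1) b ∈ T ↔ b ∈ T)
    (hin : ∃ b ∈ T, (p k).1 b ≠ (p k').1 b ∨ (p k).2 b ≠ (p k').2 b)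
    (hout : ∃ b ∉ T, (p k).1 b ≠ (p k').1 b ∨ (p k).2 b ≠ (p k').2 b) :
    ∃ i : Fin (n + 1), k < i ∧ i < k' ∧
      TropicalCensus.slope d (p i) = ∑ b ∈ T, (d ((p k').2 b) : ℤ) + ∑ b ∈ Tᶜ, (d ((p k).2 b) : ℤ) := by
  have hsm := slope_strictMono d v ε θ p hθ hdom hne
  obtain ⟨r, hr, hrT, hrT', h₁, h₂⟩ := exists_present_slope_between d v ε (hθ hkk') (hdom k) (hdom k') T hT hin hout
  obtain ⟨i, hi⟩ := exists_index_of_mem_slopeSet d v ε θ p hθ hdom hne htight (slope_mem_slopeSet d r)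
  refine ⟨i, ?_, ?_, ?_⟩
  · exact hsm.lt_iff_lt.mp (by rw [hi]; exact h₁)
  · exact hsm.lt_iff_lt.mp (by rw [hi]; exact h₂)
  · rw [hi]; exact slope_hybrid d (p k) (p k') r T hrT hrT'

/-- **MIDPOINT LAW.**  In a chain exhausting the slope budget, a COMPOSITE pair `(p_k, p_k')` (`k < k'`, separating invariant block `T`)
has `slope p_k + slope p_k' = slope p_i + slope p_j` for two chain indices strictly between, `k < i < k'`, `k < j < k'` — the block `T`
lands on `p_i`, its complement on `p_j`. [this cell] -/
theorem midpoint_law (hθ : StrictMono θ) (hdom : ∀ k, IsDominant d v ε (θ k) (p k))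
    (hne : ∀ k : Fin n, p k.castSucc ≠ p k.succ) (htight : (slopeSet m d).card ≤ n + 1)
    {k k' : Fin (n + 1)} (hkk' : k < k') (T : Finset (Fin m)) (hT : ∀ b, ((p k).1⁻¹ * (p k').1) b ∈ T ↔ b ∈ T)
    (hin : ∃ b ∈ T, (p k).1 b ≠ (p k').1 b ∨ (p k).2 b ≠ (p k').2 b)
    (hout : ∃ b ∉ T, (p k).1 b ≠ (p k').1 b ∨ (p k).2 b ≠ (p k').2 b) :
    ∃ i j : Fin (n + 1), k < i ∧ i < k' ∧ k < j ∧ j < k' ∧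
      TropicalCensus.slope d (p i) = ∑ b ∈ T, (d ((p k').2 b) : ℤ) + ∑ b ∈ Tᶜ, (d ((p k).2 b) : ℤ) ∧
      TropicalCensus.slope d (p j) = ∑ b ∈ T, (d ((p k).2 b) : ℤ) + ∑ b ∈ Tᶜ, (d ((p k').2 b) : ℤ) ∧
      TropicalCensus.slope d (p k) + TropicalCensus.slope d (p k') = TropicalCensus.slope d (p i) + TropicalCensus.slope d (p j) := by
  obtain ⟨i, hki, hik', hi⟩ := exists_between_of_split d v ε θ p hθ hdom hne htight hkk' T hT hin hout
  have hTc := compl_invariant ((p k).1⁻¹ * (p k').1) T hT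
  have hin' : ∃ b ∈ Tᶜ, (p k).1 b ≠ (p k').1 b ∨ (p k).2 b ≠ (p k').2 b := by
    obtain ⟨b, hb, h⟩ := hout; exact ⟨b, Finset.mem_compl.mpr hb, h⟩
  have hout' : ∃ b ∉ Tᶜ, (p k).1 b ≠ (p k').1 b ∨ (p k).2 b ≠ (p k').2 b := by
    obtain ⟨b, hb, h⟩ := hin; exact ⟨b, fun hc => (Finset.mem_compl.mp hc) hb, h⟩
  obtain ⟨j, hkj, hjk', hj⟩ := exists_between_of_split d v ε θ p hθ hdom hne htight hkk' Tᶜ hTc hin' hout'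
  rw [compl_compl, add_comm] at hj
  refine ⟨i, j, hki, hik', hkj, hjk', hi, hj, ?_⟩
  rw [hi, hj, slope_eq_sum_add_sum_compl d (p k) T, slope_eq_sum_add_sum_compl d (p k') T]
  ring

/-! ## 5. Second-order atomicity: pairs two steps apart -/

/-- **SECOND-ORDER ATOMICITY (arithmetic progression).**  In a chain exhausting the slope budget, if the pair `(p_{k}, p_{k+2})` is composite
(separating invariant block `T` of `σ_k⁻¹σ_{k+2}`), then the three consecutive slopes are in arithmetic progression:
`slope p_k + slope p_{k+2} = 2 · slope p_{k+1}`. [this cell] -/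
theorem two_apart_ap (hθ : StrictMono θ) (hdom : ∀ k, IsDominant d v ε (θ k) (p k))
    (hne : ∀ k : Fin n, p k.castSucc ≠ p k.succ) (htight : (slopeSet m d).card ≤ n + 1)
    {k₀ k₁ k₂ : Fin (n + 1)} (h₁ : (k₁ : ℕ) = k₀ + 1) (h₂ : (k₂ : ℕ) = k₀ + 2)
    (T : Finset (Fin m)) (hT : ∀ b, ((p k₀).1⁻¹ * (p k₂).1) b ∈ T ↔ b ∈ T)
    (hin : ∃ b ∈ T, (p k₀).1 b ≠ (p k₂).1 b ∨ (p k₀).2 b ≠ (p k₂).2 b)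
    (hout : ∃ b ∉ T, (p k₀).1 b ≠ (p k₂).1 b ∨ (p k₀).2 b ≠ (p k₂).2 b) :
    TropicalCensus.slope d (p k₀) + TropicalCensus.slope d (p k₂) = 2 * TropicalCensus.slope d (p k₁) := by
  have hkk' : k₀ < k₂ := Fin.lt_def.mpr (by omega)
  obtain ⟨i, j, hki, hik', hkj, hjk', -, -, hsum⟩ := midpoint_law d v ε θ p hθ hdom hne htight hkk' T hT hin hout
  have hi : i = k₁ := by
    apply Fin.ext
    have := Fin.lt_def.mp hki; have := Fin.lt_def.mp hik'; omega
  have hj : j = k₁ := by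
    apply Fin.ext
    have := Fin.lt_def.mp hkj; have := Fin.lt_def.mp hjk'; omega
  rw [hsum, hi, hj]; ring

/-- **each block carries the common difference**: in the situation of `two_apart_ap`, the block `T` raises the exponent mass by exactly one
step, `Σ_{b ∈ T} d(λ_{k+2} b) − Σ_{b ∈ T} d(λ_k b) = slope p_{k+1} − slope p_k` (and so does its complement). [this cell] -/
theorem two_apart_block (hθ : StrictMono θ) (hdom : ∀ k, IsDominant d v ε (θ k) (p k))
    (hne : ∀ k : Fin n, p k.castSucc ≠ p k.succ) (htight : (slopeSet m d).card ≤ n + 1)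
    {k₀ k₁ k₂ : Fin (n + 1)} (h₁ : (k₁ : ℕ) = k₀ + 1) (h₂ : (k₂ : ℕ) = k₀ + 2)
    (T : Finset (Fin m)) (hT : ∀ b, ((p k₀).1⁻¹ * (p k₂).1) b ∈ T ↔ b ∈ T)
    (hin : ∃ b ∈ T, (p k₀).1 b ≠ (p k₂).1 b ∨ (p k₀).2 b ≠ (p k₂).2 b)
    (hout : ∃ b ∉ T, (p k₀).1 b ≠ (p k₂).1 b ∨ (p k₀).2 b ≠ (p k₂).2 b) :
    ∑ b ∈ T, (d ((p k₂).2 b) : ℤ) - ∑ b ∈ T, (d ((p k₀).2 b) : ℤ) =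
      TropicalCensus.slope d (p k₁) - TropicalCensus.slope d (p k₀) := by
  have hkk' : k₀ < k₂ := Fin.lt_def.mpr (by omega)
  obtain ⟨i, hki, hik', hi⟩ := exists_between_of_split d v ε θ p hθ hdom hne htight hkk' T hT hin hout
  have hik : i = k₁ := by
    apply Fin.ext
    have := Fin.lt_def.mp hki; have := Fin.lt_def.mp hik'; omega
  rw [← hik, hi, slope_eq_sum_add_sum_compl d (p k₀) T]
  ring

/-- **contrapositive: off arithmetic progressions the terms two apart differ by ONE orbit.**  In a chain exhausting the slope budget, if
`slope p_k + slope p_{k+2} ≠ 2·slope p_{k+1}` then for every column set `T` invariant under `σ_k⁻¹σ_{k+2}` the terms `p_k`, `p_{k+2}` agree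
(row AND class) on all of `T` or on all of `Tᶜ`. [this cell] -/
theorem two_apart_atomic_of_not_ap (hθ : StrictMono θ) (hdom : ∀ k, IsDominant d v ε (θ k) (p k))
    (hne : ∀ k : Fin n, p k.castSucc ≠ p k.succ) (htight : (slopeSet m d).card ≤ n + 1)
    {k₀ k₁ k₂ : Fin (n + 1)} (h₁ : (k₁ : ℕ) = k₀ + 1) (h₂ : (k₂ : ℕ) = k₀ + 2)
    (hnap : TropicalCensus.slope d (p k₀) + TropicalCensus.slope d (p k₂) ≠ 2 * TropicalCensus.slope d (p k₁))
    (T : Finset (Fin m)) (hT : ∀ b, ((p k₀).1⁻¹ * (p k₂).1) b ∈ T ↔ b ∈ T) :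
    (∀ b ∈ T, (p k₀).1 b = (p k₂).1 b ∧ (p k₀).2 b = (p k₂).2 b) ∨
    (∀ b ∉ T, (p k₀).1 b = (p k₂).1 b ∧ (p k₀).2 b = (p k₂).2 b) := by
  by_contra h
  rw [not_or] at h
  obtain ⟨h1, h2⟩ := h
  have hin : ∃ b ∈ T, (p k₀).1 b ≠ (p k₂).1 b ∨ (p k₀).2 b ≠ (p k₂).2 b := by
    by_contra hc; push Not at hc; exact h1 fun b hb => hc b hb
  have hout : ∃ b ∉ T, (p k₀).1 b ≠ (p k₂).1 b ∨ (p k₀).2 b ≠ (p k₂).2 b := by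
    by_contra hc; push Not at hc; exact h2 fun b hb => hc b hb
  exact hnap (two_apart_ap d v ε θ p hθ hdom hne htight h₁ h₂ T hT hin hout)

/-! ## 6. Census currency: counting-tight chains (`multichoose K m ≤ n + 1`), signed hypotheses -/

/-- **midpoint law, census form**: a sign-alternating dominant chain attaining the slope-counting ceiling (`multichoose K m ≤ n + 1`,
i.e. a counting-tight chain) satisfies the midpoint law for every composite pair. [this cell] -/
theorem midpoint_law_of_multichoose_le (hθ : StrictMono θ) (hdom : ∀ k, IsDominant d v ε (θ k) (p k))
    (halt : ∀ k : Fin n, termSign ε (p k.castSucc) * termSign ε (p k.succ) < 0) (htight : Nat.multichoose K m ≤ n + 1)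
    {k k' : Fin (n + 1)} (hkk' : k < k') (T : Finset (Fin m)) (hT : ∀ b, ((p k).1⁻¹ * (p k').1) b ∈ T ↔ b ∈ T)
    (hin : ∃ b ∈ T, (p k).1 b ≠ (p k').1 b ∨ (p k).2 b ≠ (p k').2 b)
    (hout : ∃ b ∉ T, (p k).1 b ≠ (p k').1 b ∨ (p k).2 b ≠ (p k').2 b) :
    ∃ i j : Fin (n + 1), k < i ∧ i < k' ∧ k < j ∧ j < k' ∧
      TropicalCensus.slope d (p k) + TropicalCensus.slope d (p k') = TropicalCensus.slope d (p i) + TropicalCensus.slope d (p j) := by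
  obtain ⟨i, j, hki, hik', hkj, hjk', -, -, hsum⟩ := midpoint_law d v ε θ p hθ hdom (ne_succ_of_alternating ε p halt)
    ((card_slopeSet_le_multichoose d).trans htight) hkk' T hT hin hout
  exact ⟨i, j, hki, hik', hkj, hjk', hsum⟩

/-- **second-order atomicity, census form**: in a counting-tight sign-alternating chain, a composite pair two steps apart forces an
arithmetic progression of the three slopes. [this cell] -/
theorem two_apart_ap_of_multichoose_le (hθ : StrictMono θ) (hdom : ∀ k, IsDominant d v ε (θ k) (p k))
    (halt : ∀ k : Fin n, termSign ε (p k.castSucc) * termSign ε (p k.succ) < 0) (htight : Nat.multichoose K m ≤ n + 1)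
    {k₀ k₁ k₂ : Fin (n + 1)} (h₁ : (k₁ : ℕ) = k₀ + 1) (h₂ : (k₂ : ℕ) = k₀ + 2)
    (T : Finset (Fin m)) (hT : ∀ b, ((p k₀).1⁻¹ * (p k₂).1) b ∈ T ↔ b ∈ T)
    (hin : ∃ b ∈ T, (p k₀).1 b ≠ (p k₂).1 b ∨ (p k₀).2 b ≠ (p k₂).2 b)
    (hout : ∃ b ∉ T, (p k₀).1 b ≠ (p k₂).1 b ∨ (p k₀).2 b ≠ (p k₂).2 b) :
    TropicalCensus.slope d (p k₀) + TropicalCensus.slope d (p k₂) = 2 * TropicalCensus.slope d (p k₁) :=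
  two_apart_ap d v ε θ p hθ hdom (ne_succ_of_alternating ε p halt) ((card_slopeSet_le_multichoose d).trans htight)
    h₁ h₂ T hT hin hout

/-- **off arithmetic progressions, terms two apart of a counting-tight chain move one orbit** (census form). [this cell] -/
theorem two_apart_atomic_of_multichoose_le (hθ : StrictMono θ) (hdom : ∀ k, IsDominant d v ε (θ k) (p k))
    (halt : ∀ k : Fin n, termSign ε (p k.castSucc) * termSign ε (p k.succ) < 0) (htight : Nat.multichoose K m ≤ n + 1)
    {k₀ k₁ k₂ : Fin (n + 1)} (h₁ : (k₁ : ℕ) = k₀ + 1) (h₂ : (k₂ : ℕ) = k₀ + 2)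
    (hnap : TropicalCensus.slope d (p k₀) + TropicalCensus.slope d (p k₂) ≠ 2 * TropicalCensus.slope d (p k₁))
    (T : Finset (Fin m)) (hT : ∀ b, ((p k₀).1⁻¹ * (p k₂).1) b ∈ T ↔ b ∈ T) :
    (∀ b ∈ T, (p k₀).1 b = (p k₂).1 b ∧ (p k₀).2 b = (p k₂).2 b) ∨
    (∀ b ∉ T, (p k₀).1 b = (p k₂).1 b ∧ (p k₀).2 b = (p k₂).2 b) :=
  two_apart_atomic_of_not_ap d v ε θ p hθ hdom (ne_succ_of_alternating ε p halt)
    ((card_slopeSet_le_multichoose d).trans htight) h₁ h₂ hnap T hT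

end Chain

end Summit.ValiantsHypothesis.ValiantsHypothesis.Theorems.KPlusLogSqLaw.LongRangeAtom
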